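import Literature.IUT.LogThetaLattice.PacketLogVolumes
import Literature.IUT.LogVolume.ProductVolume

/-!
# [IUTchIII] Proposition 3.9 (i): the typer's packet log-volume / procession-normalization ARE the
# campaign-S weighted log-volume / procession average (named identifications for the Cor. 3.12 crew)

S. Mochizuki, *Inter-universal Teichmüller theory III*, kurims manuscript (May 2020), §3, Proposition
3.9 (i), kurims pp. 115–116. Two developments of the same printed notions exist in the tree: the
statement-typer's `Literature.IUT.LogThetaLattice.packetLogVolume` / `processionNormalized`
(`PacketLogVolumes.lean`, p404053: abstract measures `μ_i` on the direct summands) and campaign-S's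
`Literature.IUT.LogVolume.IntegralStructure.weightedLogVolume` / `processionAverage`
(`ProductVolume.lean` / `PacketVolume.lean`: Haar measures normalised by integral structures,
nonarchimedean local fields). abc-iut-c312-6 (STATUS 2026-08-25T18:49:18Z, W2-C) asked for "the named
identifications … `packetLogVolume = Σ w_i ·` S2 normalized log-volume". This file PROVES them — they
are definitional once the typer's abstract measures are instantiated by the integral structures' Haar
measures: `packetLogVolume_eq_weightedLogVolume` (this file; the companion identification
`processionNormalized = LogVolume.processionAverage` over `Fin l^⋇` is `ProcessionAverageBridge.lean`,
which waits on the olean of `LogVolume/PacketVolume.lean`). No new definitions. Tag form [claim: Mochizuki2012, status: disputed].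
-/

namespace Literature.IUT.LogThetaLattice

open MeasureTheory

universe u v

/-- **[IUTchIII] Prop. 3.9 (i), p. 115 — identification of the two formalisations of the packet
log-volume**: with the summand measures taken to be the normalised Haar measures `(Λ_j).haar` of
campaign-S integral structures `Λ_j ⊆ V_j`, the typer's `packetLogVolume w μ A = Σ_j w_j · log μ_j(A_j)` IS
campaign-S's `IntegralStructure.weightedLogVolume Λ w A` — PROVED (definitional).
[claim: Mochizuki2012, status: disputed] -/
theorem packetLogVolume_eq_weightedLogVolume {J : Type u} [Fintype J] {V : J → Type v}
    [∀ j, AddCommGroup (V j)] [∀ j, TopologicalSpace (V j)] [∀ j, IsTopologicalAddGroup (V j)]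
    [∀ j, MeasurableSpace (V j)] [∀ j, BorelSpace (V j)]
    (Λ : ∀ j, LogVolume.IntegralStructure (V j)) (w : J → ℝ) (A : ∀ j, Set (V j)) :
    packetLogVolume w (fun j => (Λ j).haar) A = LogVolume.IntegralStructure.weightedLogVolume Λ w A :=
  rfl

end Literature.IUT.LogThetaLattice
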